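import Summits.MatrixMultiplication.MatrixMultiplication.Theorems.SaturationLadderLevelTwoKit
import HarnessLib

/-!
# Level 2 of the saturation ladder — the laser-block kit at `q = 14`
# (route `SaturationLadder`, node `TailDescentTwo`, lens 1, gen 22)

Cell `decomp-mm`, lens 1 («grading / quantitative ladder»), gen 22.  No named facts, no sorry.  The
`q = 14` twins of the three `q = 6` block lemmas of `SaturationLadderLevelTwoKit` (the laser block
`blockOf14` of a word over the level-2 labels for `CW_14^{⊗2}` over `ℂ`, constant runs `blk14`,
concatenations `app14`) and the packing bound `R̃(CW_14^{⊗2}) ≤ 256`; used by the far rung `k = 10`,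
`ω(1,10,1) ≤ 412/37` (`SaturationLadderLevelTwoK10Word`, `SaturationLadderLevelTwoK10`): under the
format cap `A^{10} ≤ B` the `3 : 3 : 2` family kernel is feasible from `q = 13` on and best at
`q = 14` (real optima `11.1339 (q=13)`, `11.1332 (q=14)`, `11.1344 (q=15)`).  The design-independent
rest (used support `supp14`, the zero-row penalty lemma, entropy bookkeeping) is imported from the
`q = 6` kit.

## References

* F. Le Gall, *Faster algorithms for rectangular matrix multiplication*, FOCS 2012,
  arXiv:1204.1111, §3, §6.1. [LeGall2012]
* D. Coppersmith, S. Winograd, *Matrix multiplication via arithmetic progressions*,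
  J. Symbolic Comput. 9 (1990), §6, §8. [CoppersmithWinograd1990]
-/

set_option linter.dupNamespace false
set_option autoImplicit false

noncomputable section

open Finset Real
open scoped BigOperators

namespace Summit.MatrixMultiplication.MatrixMultiplication.Theorems.SaturationLadderLevelTwoKit14

open Literature.Computability.AlgebraicComplexity
open Literature.Barriers.MatrixMultiplication (bigCwTensor)
open SaturationLadderLevelTwoKit (PL5)

/-! ## Laser blocks over `CW_14^{⊗2}` -/

/-- The laser block of a word over the level-2 labels, for `CW_14^{⊗2}` over `ℂ`. [folklore] -/
abbrev blockOf14 {d : ℕ} (w : Fin d → PL5) :=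
  laserBlock cwLev2 cwLev2 cwLev2 (bigCwSq ℂ 14) w

/-- A constant run of a component with format value `(1; A, B, C)` is worth `(1; Aⁿ, Bⁿ, Cⁿ)`
(`q = 14`). [folklore] -/
theorem blk14 (s : PL5) (n : ℕ) {A B C : ℝ}
    (h : HasFormatValue (cwSqComp ℂ 14 s.1 s.2.1 s.2.2) 1 A B C)
    (hA : 0 ≤ A := by positivity) (hB : 0 ≤ B := by positivity)
    (hC : 0 ≤ C := by positivity) :
    HasFormatValue (blockOf14 (fun _ : Fin n => s)) 1 (A ^ n) (B ^ n) (C ^ n) := by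
  simpa using h.laserBlock_const cwLev2 cwLev2 cwLev2 (bigCwSq ℂ 14) zero_le_one hA hB hC n

/-- Concatenation multiplies format values (value `1`, `q = 14`). [folklore] -/
theorem app14 {m n : ℕ} {w : Fin m → PL5} {w' : Fin n → PL5} {A B C A' B' C' : ℝ}
    (h : HasFormatValue (blockOf14 w) 1 A B C) (h' : HasFormatValue (blockOf14 w') 1 A' B' C')
    (hA : 0 ≤ A := by positivity) (hA' : 0 ≤ A' := by positivity)
    (hB : 0 ≤ B := by positivity) (hB' : 0 ≤ B' := by positivity)
    (hC : 0 ≤ C := by positivity) (hC' : 0 ≤ C' := by positivity) :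
    HasFormatValue (blockOf14 (Fin.append w w')) 1 (A * A') (B * B') (C * C') := by
  simpa using h.laserBlock_append cwLev2 cwLev2 cwLev2 (bigCwSq ℂ 14) h' zero_le_one zero_le_one
    hA hA' hB hB' hC hC'

/-! ## The packing bound -/

/-- `R̃(CW_14^{⊗2}) ≤ 256` (sub-multiplicativity and the border-rank bound `R̃(CW_q) ≤ q+2`).
[cite: CoppersmithWinograd1990, §6 and §8] -/
theorem asymptoticRank_bigCwSq_fourteen_le : asymptoticRank (bigCwSq ℂ 14) ≤ 256 := by
  have h := asymptoticRank_bigCwTensor_le ℂ 14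
  have h0 := asymptoticRank_nonneg (bigCwTensor ℂ 14)
  calc asymptoticRank (bigCwSq ℂ 14)
      ≤ asymptoticRank (bigCwTensor ℂ 14) * asymptoticRank (bigCwTensor ℂ 14) :=
        asymptoticRank_kronecker_le _ _
    _ ≤ 16 * 16 :=
        mul_le_mul (by norm_num at h; linarith) (by norm_num at h; linarith) h0 (by norm_num)
    _ = 256 := by norm_num

end Summit.MatrixMultiplication.MatrixMultiplication.Theorems.SaturationLadderLevelTwoKit14

end
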